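import Mathlib.CategoryTheory.Action.Concrete
import Literature.AnabelianGeometry.EtaleTheta.LogDivisorModelCoordinates

/-!
# [EtTh] Def. 3.3 (iii), step 1: the Galois group of a universal combinatorial covering acting on the
# Def. 3.1 interface, and the monoids `Div⁺(Z^log_∞)^{Gal(Z^log_∞/Y^log)}`, `Mero(Z^log_∞)^{Gal(Z^log_∞/Y^log)}`
# as functors on the coverings dominated by `Z^log_∞`

S. Mochizuki, *The étale theta function …*, Publ. RIMS **45** (2009) [MochizukiEtTh2009], §3: Def. 3.1 /
Prop. 3.2 (PRIMS PDF p.70), Def. 3.3 (iii) and Rmk. 3.3.1 (p.73–74) [cite: MochizukiEtTh2009, Def 3.3 p.73].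

Def. 3.3 (iii): "for any connected tempered covering `Y^log → X^log`, it makes sense to define
`Φ₀(Y^log) := lim_{Z^log_∞} Div⁺(Z^log_∞)^{Gal(Z^log_∞/Y^log)}`, `B₀(Y^log) := lim Mero(Z^log_∞)^{Gal(Z^log_∞/Y^log)}`
— where the inductive limits range over the `Δ^fil`-closures `Z^log_∞ → Y^log` of `Y^log → X^log` …
the assignments `Y^log ↦ Φ₀(Y^log)`, `Y^log ↦ B₀(Y^log)` determine functors `Φ₀, B₀ : D₀ → 𝔐𝔬𝔫`".
Rmk. 3.3.1: "the set of primes of `Div⁺(Z^log_∞)^{Gal(Z^log_∞/Y^log)}` … is in natural bijective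
correspondence with the set of `Gal(Z^log_∞/Y^log)`-orbits of prime log-divisors on `Z^log_∞`";
"different `Δ^fil`-closures … differ only by an extension of the base field".

WHAT IS TYPED HERE (class (b) MODEL/CONSTRUCTION data of the abc-iut cell, L2 rules 2026-08-26 (B)(3);
the frozen interface `LogDivisorModel` of `TemperedCoverings.lean` is consumed BY NAME, never edited):
ONE TERM of the inductive limit.  Fix a universal combinatorial covering `Z^log_∞` (an inhabitant
`Z : LogDivisorModel` of the Def. 3.1 / Prop. 3.2 interface) and the group `G = Gal(Z^log_∞/X^log)`.

* `LogDivisorModel.GaloisAction Z G` — the PARAMETER RECORD of the action of `G` on the interface: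
  `G` acts by automorphisms on the meromorphic functions `Fn` and on the log-divisors `DIV`, permutes the
  cusps and the irreducible components of the special fibre compatibly with the multiplicities of
  Def. 3.1 (i) (Rmk. 3.3.1's "orbits of prime log-divisors"), preserves effectivity, Cartier-ness,
  log-meromorphy, the constants `L^×` and `O_L^▷`, and commutes with "divisor of zeroes and poles".
  These are the structural laws of a group acting on a log scheme and its functions/divisors — data, not
  a published result; the record is inhabited (`GaloisAction.trivial`: the trivial action, any `Z`, `G`).
* `LogDivisorModel.CuspLaws Z` — two tacit compatibilities of Def. 3.1 (i) that the v3 interface does not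
  record and that Def. 3.3 (iii)'s decomposition "non-cuspidal × cuspidal" uses: cuspidal log-divisors
  are Cartier (the cusps are sections into the smooth locus of the stable model), and an EFFECTIVE
  log-divisor is cuspidal iff its multiplicities along the special fibre vanish (the interface pins the
  complement `nonCuspidal` by `divPlusEquiv_nonCuspidal` but `cuspidal` only up to `IsCompl`).  A
  `Prop`-valued predicate bundle over the frozen structure (class (c)); inhabited at `LogDivisorModel.toy`
  (see `DivisorMonoidsOfGaloisCovering.lean`).
* the coverings of `X^log` DOMINATED BY `Z^log_∞` are typed, through the fibre functor at `Z^log_∞`, as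
  `G`-sets `S : Action (Type u) G` (Mathlib; the connected coverings `Y^log` of Def. 3.3's `D₀` are the
  transitive ones `S = G/H`, `H = Gal(Z^log_∞/Y^log)`; a general `G`-set is a disjoint union of such).
  On them Def. 3.3 (iii)'s formulas read VERBATIM as `G`-equivariant maps:
  `GaloisAction.phiZero A S = Hom_G(S, Div⁺(Z^log_∞))` (`= Div⁺(Z^log_∞)^H` for `S = G/H`) and
  `GaloisAction.bZero A S = Hom_G(S, Mero(Z^log_∞))` (`= Mero(Z^log_∞)^H`), contravariant in `S` by
  pull-back along covering maps: the functors `GaloisAction.PhiZero A`, `GaloisAction.BZero A :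
  (Action (Type u) G)ᵒᵖ ⥤ CommMonCat` ("`Φ₀, B₀ : D₀ → 𝔐𝔬𝔫`").
The natural transformation `B₀ → Φ₀^gp`, `F₀`, the (non-)cuspidal submonoids and the assembled
`DivisorMonoids` record are in `DivisorMonoidsOfGaloisCovering.lean`; Prop. 3.4 (ii) at this data is in
`Discharge/Sec3Prop34iiOfGaloisCovering.lean`.  No named Prop fact, no instance, no sorry.  HONEST
FRAMING: a construction over typed interfaces (one level of a limit the tree cannot yet form:
TODO-merge(abc-iut-L3-t2), tempered filters / `Δ^fil`-closures); nothing here bears on [IUTchIII]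
Cor. 3.12; typed ≠ proved.
-/

namespace Literature.AnabelianGeometry.EtaleTheta

open CategoryTheory Opposite

namespace LogDivisorModel

universe u

variable (Z : LogDivisorModel.{u})

/-! ## The parameter record: `Gal(Z^log_∞/X^log)` acting on the Def. 3.1 interface -/

/-- **The Galois group `G = Gal(Z^log_∞/X^log)` of a universal combinatorial covering acting on the
Def. 3.1 data** (parameter record, class (b)): actions by automorphisms on the nonzero meromorphic
functions and on the log-divisors, permutation actions on the cusps and on the irreducible components of
the special fibre, with the structural compatibilities — multiplicities (Def. 3.1 (i); Rmk. 3.3.1 "orbits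
of prime log-divisors"), effectivity, Cartier-ness, log-meromorphy, constants `L^×` / `O_L^▷`, and
"divisor of zeroes and poles" are respected. [cite: MochizukiEtTh2009, Def 3.3 p.73] -/
structure GaloisAction (G : Type u) [Group G] : Type u where
  /-- `G` acts on the nonzero meromorphic functions on `Z_∞` by group automorphisms -/
  actFn : G →* MulAut Z.Fn
  /-- `G` acts on the log-divisors `DIV(Z^log_∞)` by group automorphisms -/
  actDIV : G →* MulAut Z.DIV
  /-- `G` permutes the cusps of `Z^log_∞` -/
  permCusp : G →* Equiv.Perm Z.Cusp
  /-- `G` permutes the irreducible components of the special fibre of `Z^log_∞` -/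
  permComp : G →* Equiv.Perm Z.Comp
  /-- effective log-divisors go to effective log-divisors -/
  act_mem_DIVplus : ∀ (g : G) {d : Z.DIV}, d ∈ Z.DIVplus → actDIV g d ∈ Z.DIVplus
  /-- Cartier log-divisors go to Cartier log-divisors -/
  act_mem_Div : ∀ (g : G) {d : Z.DIV}, d ∈ Z.Div → actDIV g d ∈ Z.Div
  /-- log-meromorphic functions go to log-meromorphic functions -/
  act_mem_logMero : ∀ (g : G) {f : Z.Fn}, f ∈ Z.logMero → actFn g f ∈ Z.logMero
  /-- constants (`L^×`) go to constants (`G` acts over `K`, so it stabilises the constant field) -/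
  act_mem_const : ∀ (g : G) {f : Z.Fn}, f ∈ Z.const → actFn g f ∈ Z.const
  /-- integral constants (`O_L^▷`) go to integral constants -/
  act_mem_intConst : ∀ (g : G) {f : Z.Fn}, f ∈ Z.intConst → actFn g f ∈ Z.intConst
  /-- "divisor of zeroes and poles" is equivariant -/
  divisor_act : ∀ (g : G) (f : Z.logMero),
    Z.divisor ⟨actFn g f, act_mem_logMero g f.2⟩ = actDIV g (Z.divisor f)
  /-- the multiplicity of `g · d` at the prime log-divisor `g · x` is the multiplicity of `d` at `x`
  (Def. 3.1 (i) / Rmk. 3.3.1: `G` acts on `DIV⁺ ≅ ℕ^{cusps ⊔ components}` through its permutation of the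
  prime log-divisors) -/
  mult_act : ∀ (g : G) (d : Z.DIVplus) (x : Z.Idx),
    Z.mult ⟨actDIV g d, act_mem_DIVplus g d.2⟩ (Sum.map (permCusp g) (permComp g) x) = Z.mult d x

/-- **Tacit compatibilities of Def. 3.1 (i)** not recorded by the v3 interface `LogDivisorModel`
(predicate bundle, class (c)): (1) cuspidal log-divisors are Cartier ("the divisor of cusps" consists of
sections into the smooth locus of the stable model); (2) an effective log-divisor is cuspidal iff it has
no multiplicity along the irreducible components of the special fibre. [cite: MochizukiEtTh2009, Def 3.1 p.70] -/
structure CuspLaws : Prop where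
  /-- cuspidal log-divisors are Cartier -/
  cuspidal_le_Div : Z.cuspidal ≤ Z.Div
  /-- an effective log-divisor is cuspidal iff its multiplicities along the special fibre vanish -/
  mem_cuspidal_iff : ∀ d : Z.DIVplus, (d : Z.DIV) ∈ Z.cuspidal ↔ ∀ c : Z.Comp, Z.mult d (Sum.inr c) = 0

namespace GaloisAction

variable {Z} {G : Type u} [Group G] (A : Z.GaloisAction G)

/-- **The trivial action** (every `g` acts as the identity) satisfies every law: the parameter record is
inhabited for every `Z` and `G`. [cite: MochizukiEtTh2009, Def 3.3 p.73] -/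
def trivial (Z : LogDivisorModel.{u}) (G : Type u) [Group G] : Z.GaloisAction G where
  actFn := 1
  actDIV := 1
  permCusp := 1
  permComp := 1
  act_mem_DIVplus _ _ h := h
  act_mem_Div _ _ h := h
  act_mem_logMero _ _ h := h
  act_mem_const _ _ h := h
  act_mem_intConst _ _ h := h
  divisor_act _ _ := rfl
  mult_act _ d x := by cases x <;> rfl

/-- The parameter record is inhabited. [cite: MochizukiEtTh2009, Def 3.3 p.73] -/
theorem nonempty (Z : LogDivisorModel.{u}) (G : Type u) [Group G] : Nonempty (Z.GaloisAction G) :=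
  ⟨trivial Z G⟩

/-! ### The action on prime log-divisors, coordinates, and the canonical parts -/

/-- The permutation action of `G` on the prime log-divisors `cusps ⊔ components`.
[cite: MochizukiEtTh2009, Rmk 3.3.1 p.73] -/
def permIdx : G →* Equiv.Perm Z.Idx :=
  (Equiv.Perm.sumCongrHom Z.Cusp Z.Comp).comp (A.permCusp.prod A.permComp)

/-- `permIdx g = Sum.map (permCusp g) (permComp g)`. [cite: MochizukiEtTh2009, Rmk 3.3.1 p.73] -/
@[simp] theorem permIdx_apply (g : G) (x : Z.Idx) :
    A.permIdx g x = Sum.map (A.permCusp g) (A.permComp g) x := by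
  cases x <;> rfl

/-- Every prime log-divisor is `g · x` for some `x`. [cite: MochizukiEtTh2009, Rmk 3.3.1 p.73] -/
theorem permIdx_surjective (g : G) (y : Z.Idx) : ∃ x, A.permIdx g x = y :=
  ⟨A.permIdx g⁻¹ y, by rw [← Equiv.Perm.mul_apply, ← map_mul, mul_inv_cancel, map_one, Equiv.Perm.one_apply]⟩

/-- The action on effective log-divisors. [cite: MochizukiEtTh2009, Def 3.3 p.73] -/
def actDIVplus (g : G) (d : Z.DIVplus) : Z.DIVplus := ⟨A.actDIV g d, A.act_mem_DIVplus g d.2⟩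

/-- Underlying log-divisor of `actDIVplus g d`. [cite: MochizukiEtTh2009, Def 3.3 p.73] -/
@[simp] theorem coe_actDIVplus (g : G) (d : Z.DIVplus) : (A.actDIVplus g d : Z.DIV) = A.actDIV g d := rfl

/-- Multiplicities are equivariant. [cite: MochizukiEtTh2009, Rmk 3.3.1 p.73] -/
theorem mult_actDIVplus (g : G) (d : Z.DIVplus) (x : Z.Idx) :
    Z.mult (A.actDIVplus g d) (A.permIdx g x) = Z.mult d x := by
  rw [permIdx_apply]
  exact A.mult_act g d x

/-- `ℤ`-coordinates are equivariant. [cite: MochizukiEtTh2009, Rmk 3.3.1 p.73] -/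
theorem coord_act (g : G) (d : Z.DIV) (x : Z.Idx) :
    Z.coord (A.actDIV g d) (A.permIdx g x) = Z.coord d x := by
  obtain ⟨a, ha, b, hb, h⟩ := Z.exists_div_eq d
  have h' : A.actDIV g d * A.actDIV g b = A.actDIV g a := by rw [← map_mul, h]
  rw [Z.coord_eq_of_mul_eq ha hb h, Z.coord_eq_of_mul_eq (A.act_mem_DIVplus g ha)
    (A.act_mem_DIVplus g hb) h', ← A.mult_actDIVplus g ⟨a, ha⟩ x, ← A.mult_actDIVplus g ⟨b, hb⟩ x]
  rfl

/-- The divisor of poles is equivariant. [cite: MochizukiEtTh2009, Def 3.3 p.73] -/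
theorem negPart_act (g : G) (d : Z.DIV) : Z.negPart (A.actDIV g d) = A.actDIVplus g (Z.negPart d) := by
  refine Z.eq_of_mult_eq fun y => ?_
  obtain ⟨x, rfl⟩ := A.permIdx_surjective g y
  rw [mult_actDIVplus, negPart, negPart, mult_ofMult, mult_ofMult, coord_act]

/-- The canonical Cartier denominator is equivariant. [cite: MochizukiEtTh2009, Def 3.3 p.73] -/
theorem cartierDen_act (g : G) (d : Z.DIV) : Z.cartierDen (A.actDIV g d) = A.actDIV g (Z.cartierDen d) := by
  rw [cartierDen, cartierDen, negPart_act, coe_actDIVplus, map_pow]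

/-- The canonical Cartier numerator is equivariant. [cite: MochizukiEtTh2009, Def 3.3 p.73] -/
theorem cartierNum_act (g : G) (d : Z.DIV) : Z.cartierNum (A.actDIV g d) = A.actDIV g (Z.cartierNum d) := by
  rw [cartierNum, cartierNum, cartierDen_act, map_mul]

/-- The non-cuspidal part is equivariant. [cite: MochizukiEtTh2009, Def 3.3 p.73] -/
theorem compPart_act (g : G) (d : Z.DIVplus) :
    Z.compPart (A.actDIVplus g d) = A.actDIVplus g (Z.compPart d) := by
  refine Z.eq_of_mult_eq fun y => ?_
  obtain ⟨x, rfl⟩ := A.permIdx_surjective g y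
  rw [mult_actDIVplus]
  rcases x with c | c
  · simp [compPart]
  · simp only [compPart, mult_ofMult, permIdx_apply, Sum.map_inr, Sum.elim_inr]
    rw [← A.mult_actDIVplus g d (Sum.inr c), permIdx_apply, Sum.map_inr]

/-- The cuspidal part is equivariant. [cite: MochizukiEtTh2009, Def 3.3 p.73] -/
theorem cuspPart_act (g : G) (d : Z.DIVplus) :
    Z.cuspPart (A.actDIVplus g d) = A.actDIVplus g (Z.cuspPart d) := by
  refine Z.eq_of_mult_eq fun y => ?_
  obtain ⟨x, rfl⟩ := A.permIdx_surjective g y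
  rw [mult_actDIVplus]
  rcases x with c | c
  · simp only [cuspPart, mult_ofMult, permIdx_apply, Sum.map_inl, Sum.elim_inl]
    rw [← A.mult_actDIVplus g d (Sum.inl c), permIdx_apply, Sum.map_inl]
  · simp [cuspPart]

/-- The divisor of `g · f` is `g ·` the divisor of `f` (field `divisor_act`, subtype form).
[cite: MochizukiEtTh2009, Def 3.3 p.73] -/
theorem divisor_act' (g : G) {f : Z.Fn} (hf : f ∈ Z.logMero) (hgf : A.actFn g f ∈ Z.logMero) :
    Z.divisor ⟨A.actFn g f, hgf⟩ = A.actDIV g (Z.divisor ⟨f, hf⟩) :=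
  A.divisor_act g ⟨f, hf⟩

/-! ## Coverings dominated by `Z^log_∞` as `G`-sets; the monoids `Φ₀(S)`, `B₀(S)` -/

section GSet

variable {S S' S'' : Action (Type u) G}

/-- Morphisms of `G`-sets are equivariant, pointwise (plumbing for the pull-back maps below). [folklore] -/
private theorem hom_ρ_apply (f : S ⟶ S') (g : G) (s : S.V) : f.hom (S.ρ g s) = S'.ρ g (f.hom s) := by
  have h := f.comm g
  exact congrFun (congrArg (fun φ : S.V ⟶ S'.V => (φ : S.V → S'.V)) h) s

end GSet

variable (S : Action (Type u) G)

/-- **`Φ₀(S) := Hom_G(S, Div⁺(Z^log_∞))`** — Def. 3.3 (iii)'s `Div⁺(Z^log_∞)^{Gal(Z^log_∞/Y^log)}` for the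
covering `Y ↔ S = G/H` (one term of the inductive limit), typed for an arbitrary `G`-set `S` as the
submonoid of `G`-equivariant maps `S → DIV(Z^log_∞)` with effective Cartier values.
[cite: MochizukiEtTh2009, Def 3.3 p.73] -/
def phiZero : Submonoid (S.V → Z.DIV) where
  carrier := {φ | (∀ s, φ s ∈ Z.Divplus) ∧ ∀ (g : G) (s : S.V), φ (S.ρ g s) = A.actDIV g (φ s)}
  mul_mem' := by
    rintro φ ψ ⟨hφ, hφ'⟩ ⟨hψ, hψ'⟩
    exact ⟨fun s => Z.Divplus.mul_mem (hφ s) (hψ s),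
      fun g s => by rw [Pi.mul_apply, Pi.mul_apply, hφ', hψ', map_mul]⟩
  one_mem' := ⟨fun _ => Z.Divplus.one_mem, fun g s => by rw [Pi.one_apply, Pi.one_apply, map_one]⟩

/-- Membership in `Φ₀(S)`. [cite: MochizukiEtTh2009, Def 3.3 p.73] -/
theorem mem_phiZero_iff (φ : S.V → Z.DIV) : φ ∈ A.phiZero S ↔
    (∀ s, φ s ∈ Z.Divplus) ∧ ∀ (g : G) (s : S.V), φ (S.ρ g s) = A.actDIV g (φ s) := Iff.rfl

/-- **`B₀(S) := Hom_G(S, Mero(Z^log_∞))`** — Def. 3.3 (iii)'s `Mero(Z^log_∞)^{Gal(Z^log_∞/Y^log)}`, typed for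
an arbitrary `G`-set `S` as the subgroup of `G`-equivariant maps `S → Fn` with log-meromorphic values
(a group: "the group of log-meromorphic functions", Def. 3.1 (ii)). [cite: MochizukiEtTh2009, Def 3.3 p.73] -/
def bZero : Subgroup (S.V → Z.Fn) where
  carrier := {b | (∀ s, b s ∈ Z.logMero) ∧ ∀ (g : G) (s : S.V), b (S.ρ g s) = A.actFn g (b s)}
  mul_mem' := by
    rintro b c ⟨hb, hb'⟩ ⟨hc, hc'⟩
    exact ⟨fun s => Z.logMero.mul_mem (hb s) (hc s),
      fun g s => by rw [Pi.mul_apply, Pi.mul_apply, hb', hc', map_mul]⟩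
  one_mem' := ⟨fun _ => Z.logMero.one_mem, fun g s => by rw [Pi.one_apply, Pi.one_apply, map_one]⟩
  inv_mem' := by
    rintro b ⟨hb, hb'⟩
    exact ⟨fun s => Z.logMero.inv_mem (hb s), fun g s => by rw [Pi.inv_apply, Pi.inv_apply, hb', map_inv]⟩

/-- Membership in `B₀(S)`. [cite: MochizukiEtTh2009, Def 3.3 p.73] -/
theorem mem_bZero_iff (b : S.V → Z.Fn) : b ∈ A.bZero S ↔
    (∀ s, b s ∈ Z.logMero) ∧ ∀ (g : G) (s : S.V), b (S.ρ g s) = A.actFn g (b s) := Iff.rfl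

variable {S} {S' : Action (Type u) G}

/-- Pull-back of log-divisors along a covering map `S → S'` (`Φ₀` is contravariant).
[cite: MochizukiEtTh2009, Def 3.3 p.73] -/
def phiZeroPull (f : S ⟶ S') : A.phiZero S' →* A.phiZero S where
  toFun φ := ⟨fun s => φ.1 (f.hom s), fun s => φ.2.1 _, fun g s => by
    show φ.1 (f.hom (S.ρ g s)) = _
    rw [hom_ρ_apply, φ.2.2]⟩
  map_one' := rfl
  map_mul' _ _ := rfl

/-- Pull-back of log-meromorphic functions along a covering map `S → S'` (`B₀` is contravariant).
[cite: MochizukiEtTh2009, Def 3.3 p.73] -/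
def bZeroPull (f : S ⟶ S') : A.bZero S' →* A.bZero S where
  toFun b := ⟨fun s => b.1 (f.hom s), fun s => b.2.1 _, fun g s => by
    show b.1 (f.hom (S.ρ g s)) = _
    rw [hom_ρ_apply, b.2.2]⟩
  map_one' := rfl
  map_mul' _ _ := rfl

/-- Pull-back, pointwise. [cite: MochizukiEtTh2009, Def 3.3 p.73] -/
@[simp] theorem phiZeroPull_apply (f : S ⟶ S') (φ : A.phiZero S') (s : S.V) :
    (A.phiZeroPull f φ).1 s = φ.1 (f.hom s) := rfl

/-- Pull-back, pointwise. [cite: MochizukiEtTh2009, Def 3.3 p.73] -/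
@[simp] theorem bZeroPull_apply (f : S ⟶ S') (b : A.bZero S') (s : S.V) :
    (A.bZeroPull f b).1 s = b.1 (f.hom s) := rfl

/-- A map of `G`-sets into a TRANSITIVE `G`-set (a connected covering `Y^log` of Def. 3.3's `D₀`) from a
nonempty one is surjective — covering maps between connected coverings dominated by `Z^log_∞` are onto.
[cite: MochizukiEtTh2009, Def 3.3 p.73] -/
theorem hom_surjective_of_transitive (f : S ⟶ S') (hS : Nonempty S.V)
    (htrans : ∀ t t' : S'.V, ∃ g : G, S'.ρ g t = t') : Function.Surjective f.hom := by
  intro t'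
  obtain ⟨s⟩ := hS
  obtain ⟨g, hg⟩ := htrans (f.hom s) t'
  exact ⟨S.ρ g s, by rw [← hg]; exact hom_ρ_apply f g s⟩

/-- **Pull-back of log-meromorphic functions along a SURJECTIVE covering map is injective** — the transition
maps of `B₀` between connected coverings dominated by `Z^log_∞` are inclusions `Mero(Z_∞)^H ↪ Mero(Z_∞)^{H'}`
(the binder `hBinj` of GAP row G-w5d179-1 holds at this data for such maps). [cite: MochizukiEtTh2009, Def 3.3 p.73] -/
theorem bZeroPull_injective (f : S ⟶ S') (hf : Function.Surjective f.hom) :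
    Function.Injective (A.bZeroPull f) := by
  intro b c h
  refine Subtype.ext (funext fun t => ?_)
  obtain ⟨s, rfl⟩ := hf t
  exact congrArg (fun ψ : A.bZero S => ψ.1 s) h

/-- Pull-back of log-divisors along a surjective covering map is injective (twin of `bZeroPull_injective`
for `Φ₀`). [cite: MochizukiEtTh2009, Def 3.3 p.73] -/
theorem phiZeroPull_injective (f : S ⟶ S') (hf : Function.Surjective f.hom) :
    Function.Injective (A.phiZeroPull f) := by
  intro φ ψ h
  refine Subtype.ext (funext fun t => ?_)
  obtain ⟨s, rfl⟩ := hf t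
  exact congrArg (fun χ : A.phiZero S => χ.1 s) h

/-- **The functor `Φ₀ : D₀ → 𝔐𝔬𝔫`** (contravariant; Def. 3.3 (iii)) on the `G`-sets.
[cite: MochizukiEtTh2009, Def 3.3 p.73] -/
def PhiZero : (Action (Type u) G)ᵒᵖ ⥤ CommMonCat.{u} where
  obj S := CommMonCat.of (A.phiZero S.unop)
  map f := CommMonCat.ofHom (A.phiZeroPull f.unop)
  map_id _ := CommMonCat.hom_ext (MonoidHom.ext fun _ => Subtype.ext (funext fun _ => rfl))
  map_comp _ _ := CommMonCat.hom_ext (MonoidHom.ext fun _ => Subtype.ext (funext fun _ => rfl))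

/-- **The functor `B₀ : D₀ → 𝔐𝔬𝔫`** (contravariant; Def. 3.3 (iii)) on the `G`-sets.
[cite: MochizukiEtTh2009, Def 3.3 p.73] -/
def BZero : (Action (Type u) G)ᵒᵖ ⥤ CommMonCat.{u} where
  obj S := CommMonCat.of (A.bZero S.unop)
  map f := CommMonCat.ofHom (A.bZeroPull f.unop)
  map_id _ := CommMonCat.hom_ext (MonoidHom.ext fun _ => Subtype.ext (funext fun _ => rfl))
  map_comp _ _ := CommMonCat.hom_ext (MonoidHom.ext fun _ => Subtype.ext (funext fun _ => rfl))

/-- `Φ₀` on objects. [cite: MochizukiEtTh2009, Def 3.3 p.73] -/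
theorem PhiZero_obj (S : (Action (Type u) G)ᵒᵖ) : A.PhiZero.obj S = CommMonCat.of (A.phiZero S.unop) := rfl

/-- `B₀` on objects. [cite: MochizukiEtTh2009, Def 3.3 p.73] -/
theorem BZero_obj (S : (Action (Type u) G)ᵒᵖ) : A.BZero.obj S = CommMonCat.of (A.bZero S.unop) := rfl

/-- `Φ₀` on morphisms is pull-back. [cite: MochizukiEtTh2009, Def 3.3 p.73] -/
theorem PhiZero_map_apply {S S' : (Action (Type u) G)ᵒᵖ} (f : S ⟶ S') (φ : A.phiZero S.unop) :
    (A.PhiZero.map f).hom φ = A.phiZeroPull f.unop φ := rfl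

/-- `B₀` on morphisms is pull-back. [cite: MochizukiEtTh2009, Def 3.3 p.73] -/
theorem BZero_map_apply {S S' : (Action (Type u) G)ᵒᵖ} (f : S ⟶ S') (b : A.bZero S.unop) :
    (A.BZero.map f).hom b = A.bZeroPull f.unop b := rfl

end GaloisAction

end LogDivisorModel

end Literature.AnabelianGeometry.EtaleTheta
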